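import Mathlib
import Literature.Computability.Complexity.Mod2SymmetricPseudoexpectation
import HarnessLib

/-!
# The symmetric pseudo-matching functional of `K_N` — Part B: the honest worlds (even `m`)

Continuation of `Mod2SymmetricPseudoexpectation.lean` (Part A; see its docstring for the statement,
the source — A. Potechin, *Sum of squares lower bounds from symmetry and a good story*, ITCS 2019,
arXiv:1711.11469 [Potechin2019] — and the plan).  This part formalises the "honest" half of
Potechin's interpolation argument (§6, Def. 6.5 "honest", Lemma 6.7; and Prop. 5.7 / Thm. 5.12 (2)):
for EVEN `m` the story values are genuine expectations over the uniform distribution on the perfect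
matchings of `K_m` ("Whenever `n` is even, the story for the MOD 2 principle corresponds to taking the
uniform distribution over permutations of a single solution", Cor. 3.10 proof sketch, 61:9), and after
conditioning on the outcome inside a vertex set `I` the conditional distribution is a single orbit of
the pointwise stabiliser `S_{[m] ∖ I}` (relative transitivity, the tree's
`Literature.Combinatorics.Optimization.exists_perm_fix_smul_eq`, Godsil–Meagher §15.2), so that a
stabiliser-symmetrised monomial decorrelates from everything (Prop. 5.7: "`E_Ω[fg] = E_Ω[f]E_Ω[g]` for
symmetric `f`").

## Contents (all proved; no named facts)

* §B1–B3 `PM m`, `pmCount`, the relabelling symmetry of the honest counts, vertex sets of partial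
  matchings (`IsPartialMatching.card_verts`: `|verts G| = 2|G|`), the one-vertex exposure
  `sum_pmCount_insert` / `sub_mul_pmCount_insert` (`(m − 2ℓ − 1)·#{M ⊇ G ∪ ab} = #{M ⊇ G}`) and
  **`storyValue_mul_card_PM`**: `Ẽ_m[x_G] · #PM(K_m) = #{M ∈ PM(K_m) : G ⊆ M}`.
* §B4 `Omega I F = {M : M ∩ E(I) = F}`, `ocount`, **`outcomeValue_mul_card_PM`**:
  `Ẽ_m[x_C 1_F] · #PM = #{M : C ⊆ M, M ∩ E(I) = F}` (`F ⊆ E(I)`).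
* §B5 stability of `Ω_F` under `stab I`, relative transitivity `exists_mem_stab_relabel_eq`, and the
  **honest identity** `card_Omega_mul_sum_ocount` /
  **`outcomeValue_mul_sum_honest`**: for even `m`, `F ⊆ E(I)` and all edge sets `A, B`,
  `Ẽ[1_F] · Σ_{σ ∈ stab I} Ẽ[x_{A ∪ σB} 1_F] = #stab I · Ẽ[x_A 1_F] · Ẽ[x_B 1_F]`.
* §B6 `card_stab`: `#stab I = (m − |I|)!`.

Part C interpolates these identities from even `m` to the odd `N` of interest.

## References

* A. Potechin, ITCS 2019, LIPIcs 124, Ex 3.4, Prop 5.7, Thm 5.12, Def 6.5, Lemma 6.7. [Potechin2019]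
* C. Godsil, K. Meagher, *Erdős–Ko–Rado Theorems: Algebraic Approaches*, CUP 2015, §15.2 (relative
  transitivity of `S_n` on perfect matchings; used through `MatchingJunta.lean`). [GodsilMeagher2015]
-/

noncomputable section

open Finset Matrix
open scoped BigOperators

namespace Literature.Computability.Complexity

namespace PseudoMatching

open Literature.Barriers.PneNP (IsPMOn perfectMatchings mem_perfectMatchings perfectMatchings_nonempty)
open Literature.Combinatorics.Optimization (innerEdges mem_innerEdges PMSol exists_perm_fix_smul_eq
  isPMOn_univ_image_map)

variable {m : ℕ}

/-! ### §B1 Perfect matchings of `K_m` and their symmetry -/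

/-- The perfect matchings of `K_m` (the honest solutions of the MOD 2 equations for even `m`).
[cite: Potechin2019, Cor. 3.10 proof sketch (61:9: "Whenever n is even, the story … corresponds to taking
the uniform distribution over permutations of a single solution")] -/
abbrev PM (m : ℕ) : Finset (Finset (Sym2 (Fin m))) := perfectMatchings (univ : Finset (Fin m))

/-- `#{M ∈ PM : G ⊆ M}`, the number of perfect matchings containing `G`. [cite: Potechin2019, Prop. 2.18 (61:6)] -/
def pmCount (G : Finset (Sym2 (Fin m))) : ℕ := ((PM m).filter fun M => G ⊆ M).card

/-- For even `m` there are perfect matchings. [cite: Potechin2019, Cor. 3.10 (61:9)] -/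
theorem card_PM_pos (hm : Even m) : 0 < (PM m).card :=
  card_pos.2 (perfectMatchings_nonempty (by simpa using hm))

/-- `relabel σ M = M.image (Sym2.map σ)`. [cite: Potechin2019, §4 (61:10)] -/
theorem relabel_eq_image (σ : Equiv.Perm (Fin m)) (A : Finset (Sym2 (Fin m))) :
    relabel σ A = A.image (Sym2.map σ) := by
  rw [relabel, map_eq_image]; rfl

/-- Relabelling maps perfect matchings to perfect matchings. [cite: Potechin2019, Prop. 5.7 (61:11)] -/
theorem relabel_mem_PM {σ : Equiv.Perm (Fin m)} {M : Finset (Sym2 (Fin m))} (hM : M ∈ PM m) :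
    relabel σ M ∈ PM m := by
  rw [mem_perfectMatchings] at hM ⊢
  rw [relabel_eq_image]
  exact isPMOn_univ_image_map σ hM

/-- Relabelling is a bijection of `PM`. [cite: Potechin2019, Prop. 5.7 (61:11)] -/
theorem relabel_mem_PM_iff {σ : Equiv.Perm (Fin m)} {M : Finset (Sym2 (Fin m))} :
    relabel σ M ∈ PM m ↔ M ∈ PM m := by
  refine ⟨fun h => ?_, relabel_mem_PM⟩
  have := relabel_mem_PM (σ := σ⁻¹) h
  rwa [relabel_inv_relabel] at this

/-- `relabel σ` is injective on edge sets. [cite: Potechin2019, §4 (61:10)] -/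
theorem relabel_injective (σ : Equiv.Perm (Fin m)) : Function.Injective (relabel σ) := fun A B h => by
  simpa [relabel_inv_relabel] using congrArg (relabel σ⁻¹) h

/-- `relabel σ A ⊆ relabel σ B ↔ A ⊆ B`. [cite: Potechin2019, §4 (61:10)] -/
theorem relabel_subset_relabel_iff {σ : Equiv.Perm (Fin m)} {A B : Finset (Sym2 (Fin m))} :
    relabel σ A ⊆ relabel σ B ↔ A ⊆ B := by
  simp only [relabel, map_subset_map]

/-- **Symmetry of the honest counts**: `#{M ⊇ σG} = #{M ⊇ G}`. [cite: Potechin2019, Prop. 5.7 (61:11)] -/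
theorem pmCount_relabel (σ : Equiv.Perm (Fin m)) (G : Finset (Sym2 (Fin m))) :
    pmCount (relabel σ G) = pmCount G := by
  unfold pmCount
  refine (card_nbij' (fun M => relabel σ⁻¹ M) (fun M => relabel σ M) (fun M hM => ?_) (fun M hM => ?_)
    (fun M _ => relabel_relabel_inv σ M) (fun M _ => relabel_inv_relabel σ M))
  · simp only [mem_coe, mem_filter] at hM ⊢
    refine ⟨relabel_mem_PM hM.1, ?_⟩
    have := relabel_subset_relabel_iff (σ := σ⁻¹).2 hM.2
    rwa [relabel_inv_relabel] at this
  · simp only [mem_coe, mem_filter] at hM ⊢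
    exact ⟨relabel_mem_PM hM.1, relabel_subset_relabel_iff.2 hM.2⟩

/-! ### §B2 Vertex sets of partial matchings -/

variable {N : ℕ}

/-- The endpoint set of a pair. [cite: Potechin2019, Def. 2.6 (61:5)] -/
def ends (e : Sym2 (Fin N)) : Finset (Fin N) := univ.filter fun v => v ∈ e

/-- Membership in the endpoint set. [cite: Potechin2019, Def. 2.6 (61:5)] -/
theorem mem_ends {e : Sym2 (Fin N)} {v : Fin N} : v ∈ ends e ↔ v ∈ e := by simp [ends]

/-- A non-loop pair has two endpoints. [cite: Potechin2019, Def. 2.6 (61:5)] -/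
theorem card_ends {e : Sym2 (Fin N)} (he : ¬ e.IsDiag) : (ends e).card = 2 := by
  induction e using Sym2.ind with
  | h a b =>
    have hab : a ≠ b := fun h => he (Sym2.mk_isDiag_iff.2 h)
    have : ends s(a, b) = {a, b} := by ext v; simp [mem_ends]
    rw [this, card_pair hab]

/-- The vertex set is the union of the endpoint sets. [cite: Potechin2019, Def. 2.6 (61:5)] -/
theorem verts_eq_biUnion (G : Finset (Sym2 (Fin N))) : verts G = G.biUnion ends := by
  ext v; simp [mem_verts, mem_ends]

/-- In a partial matching distinct edges have disjoint endpoint sets. [cite: Potechin2019, Example 3.4 (61:7)] -/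
theorem IsPartialMatching.disjoint_ends {G : Finset (Sym2 (Fin N))} (hG : IsPartialMatching G)
    {e f : Sym2 (Fin N)} (he : e ∈ G) (hf : f ∈ G) (hef : e ≠ f) : Disjoint (ends e) (ends f) := by
  rw [Finset.disjoint_left]
  intro v hve hvf
  have h2 : 2 ≤ (G.filter fun e => v ∈ e).card := by
    have hsub : ({e, f} : Finset (Sym2 (Fin N))) ⊆ G.filter fun e => v ∈ e := by
      intro x hx
      rcases mem_insert.1 hx with rfl | hx
      · exact mem_filter.2 ⟨he, mem_ends.1 hve⟩
      · rw [mem_singleton.1 hx]; exact mem_filter.2 ⟨hf, mem_ends.1 hvf⟩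
    have := card_le_card hsub
    rwa [card_pair hef] at this
  have := hG.2 v
  omega

/-- **A partial matching with `ℓ` edges has `2ℓ` vertices** (index degree `2ℓ`). [cite: Potechin2019, Def. 2.6 and Example 2.7 (61:5)] -/
theorem IsPartialMatching.card_verts {G : Finset (Sym2 (Fin N))} (hG : IsPartialMatching G) :
    (verts G).card = 2 * G.card := by
  rw [verts_eq_biUnion, card_biUnion (fun e he f hf hef => hG.disjoint_ends he hf hef)]
  rw [sum_congr rfl fun e he => card_ends (hG.1 e he), sum_const, smul_eq_mul, mul_comm]

/-- A perfect matching of `K_m` is a partial matching. [cite: Potechin2019, Cor. 3.10 (61:9)] -/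
theorem isPartialMatching_of_mem_PM {M : Finset (Sym2 (Fin m))} (hM : M ∈ PM m) : IsPartialMatching M := by
  rw [mem_perfectMatchings] at hM
  exact ⟨fun e he => hM.not_isDiag he, fun v => (hM.card_filter (mem_univ v)).le⟩

/-- Only partial matchings are contained in perfect matchings. [cite: Potechin2019, Example 3.4 (61:7)] -/
theorem pmCount_eq_zero {G : Finset (Sym2 (Fin m))} (hG : ¬ IsPartialMatching G) : pmCount G = 0 := by
  unfold pmCount
  rw [card_eq_zero, filter_eq_empty_iff]
  exact fun M hM hGM => hG ((isPartialMatching_of_mem_PM hM).subset hGM)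

/-- Adding a disjoint non-loop edge to a partial matching gives a partial matching.
[cite: Potechin2019, Example 3.4 (61:7)] -/
theorem IsPartialMatching.insert_edge {G : Finset (Sym2 (Fin N))} (hG : IsPartialMatching G) {a b : Fin N}
    (hab : a ≠ b) (ha : a ∉ verts G) (hb : b ∉ verts G) : IsPartialMatching (insert s(a, b) G) := by
  refine ⟨fun e he => ?_, fun v => ?_⟩
  · rcases mem_insert.1 he with rfl | he
    · rwa [Sym2.mk_isDiag_iff]
    · exact hG.1 e he
  · rw [filter_insert]
    split_ifs with hv
    · have hvG : (G.filter fun e => v ∈ e) = ∅ := by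
        rw [filter_eq_empty_iff]
        intro e he hve
        rcases Sym2.mem_iff.1 hv with rfl | rfl
        · exact ha (mem_verts.2 ⟨e, he, hve⟩)
        · exact hb (mem_verts.2 ⟨e, he, hve⟩)
      rw [hvG]; simp
    · exact hG.2 v

/-- Decomposing a non-empty partial matching: `insert e G` with `e ∉ G` a partial matching forces
`e = s(a,b)` with `a ≠ b` both outside `verts G`. [cite: Potechin2019, Example 3.4 (61:7)] -/
theorem IsPartialMatching.exists_of_insert {G : Finset (Sym2 (Fin N))} {e : Sym2 (Fin N)} (heG : e ∉ G)
    (h : IsPartialMatching (insert e G)) : ∃ a b : Fin N, e = s(a, b) ∧ a ≠ b ∧ a ∉ verts G ∧ b ∉ verts G := by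
  induction e using Sym2.ind with
  | h a b =>
    have hab : a ≠ b := fun hab => h.1 _ (mem_insert_self _ _) (Sym2.mk_isDiag_iff.2 hab)
    have key : ∀ v : Fin N, v ∈ s(a, b) → v ∉ verts G := by
      intro v hv hvG
      obtain ⟨f, hf, hvf⟩ := mem_verts.1 hvG
      have hne : s(a, b) ≠ f := fun h' => heG (h' ▸ hf)
      have hd := h.disjoint_ends (mem_insert_self _ _) (mem_insert_of_mem hf) hne
      exact Finset.disjoint_left.1 hd (mem_ends.2 hv) (mem_ends.2 hvf)
    exact ⟨a, b, rfl, hab, key a (Sym2.mem_mk_left a b), key b (Sym2.mem_mk_right a b)⟩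

/-! ### §B3 The honest moments: `Ẽ_m[x_G] · #PM = #{M ⊇ G}` for even `m` -/

/-- The partner of a vertex in a perfect matching: for `M ∈ PM` and a vertex `a` there is a unique
`w ≠ a` with `s(a,w) ∈ M`. [cite: Potechin2019, §3.1 (61:7, "the perfect matching contains precisely one of the edges which are incident to i")] -/
theorem exists_partner {M : Finset (Sym2 (Fin m))} (hM : M ∈ PM m) (a : Fin m) :
    ∃ w₀ : Fin m, w₀ ≠ a ∧ s(a, w₀) ∈ M ∧ ∀ w, s(a, w) ∈ M → w = w₀ := by
  rw [mem_perfectMatchings] at hM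
  obtain ⟨e, he, hae⟩ := hM.exists_mem (mem_univ a)
  refine ⟨Sym2.Mem.other hae, Sym2.other_ne (hM.not_isDiag he) hae, by rwa [Sym2.other_spec hae], fun w hw => ?_⟩
  have heq : s(a, w) = e := hM.unique hw he (Sym2.mem_mk_left a w) hae
  have hne : w ≠ a := fun h => hM.not_isDiag he (by rw [← heq, h]; exact Sym2.mk_isDiag_iff.2 rfl)
  have : s(a, w) = s(a, Sym2.Mem.other hae) := by rw [heq, Sym2.other_spec hae]
  rcases Sym2.eq_iff.1 this with ⟨-, h⟩ | ⟨h1, h2⟩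
  · exact h
  · exact absurd h2 hne

/-- If `M ⊇ G` is a perfect matching and `a ∉ verts G`, the partner of `a` is not a vertex of `G`.
[cite: Potechin2019, Example 3.4 (61:7)] -/
theorem partner_not_mem_verts {M G : Finset (Sym2 (Fin m))} (hM : M ∈ PM m) (hGM : G ⊆ M) {a w : Fin m}
    (ha : a ∉ verts G) (hw : s(a, w) ∈ M) : w ∉ verts G := by
  intro hwG
  obtain ⟨f, hf, hwf⟩ := mem_verts.1 hwG
  have hM' := mem_perfectMatchings.1 hM
  have : s(a, w) = f := hM'.unique hw (hGM hf) (Sym2.mem_mk_right a w) hwf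
  exact ha (mem_verts.2 ⟨f, hf, this ▸ Sym2.mem_mk_left a w⟩)

/-- **One-vertex exposure**: for a partial matching `G` and a vertex `a ∉ verts G`,
`Σ_{w ∉ verts G ∪ {a}} #{M ⊇ G ∪ {aw}} = #{M ⊇ G}` (the partner of `a` is one of these `w`).
[cite: Potechin2019, Example 3.4 (61:7, "the adversary wants to match 1 out of the remaining n−1 vertices with i")] -/
theorem sum_pmCount_insert {G : Finset (Sym2 (Fin m))} {a : Fin m} (ha : a ∉ verts G) :
    ∑ w ∈ univ \ insert a (verts G), pmCount (insert s(a, w) G) = pmCount G := by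
  classical
  unfold pmCount
  simp only [card_eq_sum_ones, sum_filter]
  rw [sum_comm]
  refine sum_congr rfl fun M hM => ?_
  by_cases hGM : G ⊆ M
  · simp only [insert_subset_iff, hGM, and_true, if_true]
    -- exactly one `w` in the range with `s(a,w) ∈ M`
    obtain ⟨w₀, hw₀a, hw₀M, huniq⟩ := exists_partner hM a
    have hw₀ : w₀ ∈ univ \ insert a (verts G) := by
      rw [mem_sdiff, mem_insert, not_or]
      exact ⟨mem_univ _, hw₀a, partner_not_mem_verts hM hGM ha hw₀M⟩
    have hfilt : (univ \ insert a (verts G)).filter (fun w => s(a, w) ∈ M) = {w₀} :=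
      eq_singleton_iff_unique_mem.2 ⟨mem_filter.2 ⟨hw₀, hw₀M⟩, fun w hw => huniq w (mem_filter.1 hw).2⟩
    rw [← sum_filter, hfilt, sum_singleton]
  · have : ∀ w, ¬ (insert s(a, w) G ⊆ M) := fun w h => hGM ((subset_insert _ _).trans h)
    simp [this, hGM]

/-- **Symmetry of the exposure terms**: for `w, b ∉ verts G ∪ {a}`,
`#{M ⊇ G ∪ {aw}} = #{M ⊇ G ∪ {ab}}` (apply the transposition `(w b)`, which fixes `G` and `a`).
[cite: Potechin2019, Example 3.4 (61:7, "there is nothing distinguishing i from other vertices")] -/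
theorem pmCount_insert_eq {G : Finset (Sym2 (Fin m))} {a w b : Fin m}
    (hw : w ∉ insert a (verts G)) (hb : b ∉ insert a (verts G)) :
    pmCount (insert s(a, w) G) = pmCount (insert s(a, b) G) := by
  classical
  rw [mem_insert, not_or] at hw hb
  set τ : Equiv.Perm (Fin m) := Equiv.swap w b with hτ
  have hτG : τ ∈ stab (verts G) := mem_stab.2 fun v hv =>
    Equiv.swap_apply_of_ne_of_ne (fun h => hw.2 (h ▸ hv)) (fun h => hb.2 (h ▸ hv))
  have h1 : relabel τ (insert s(a, w) G) = insert s(a, b) G := by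
    rw [relabel, map_insert, ← relabel, relabel_eq_self_of_mem_stab hτG, edgeMap_apply, Sym2.map_mk, hτ,
      Equiv.swap_apply_of_ne_of_ne (Ne.symm hw.1) (Ne.symm hb.1), Equiv.swap_apply_left]
  rw [← h1, pmCount_relabel]

/-- **The exposure recursion**: for a partial matching `G` with `ℓ` edges and a new disjoint edge `ab`,
`(m − 2ℓ − 1) · #{M ⊇ G ∪ {ab}} = #{M ⊇ G}`. [cite: Potechin2019, Example 3.4 (61:7, "x_{kl} = 1 with probability 1/(n−3)")] -/
theorem sub_mul_pmCount_insert {G : Finset (Sym2 (Fin m))} (hG : IsPartialMatching G) {a b : Fin m}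
    (hab : a ≠ b) (ha : a ∉ verts G) (hb : b ∉ verts G) :
    (m - 2 * G.card - 1) * pmCount (insert s(a, b) G) = pmCount G := by
  classical
  rw [← sum_pmCount_insert ha]
  have hbW : b ∉ insert a (verts G) := by rw [mem_insert, not_or]; exact ⟨hab.symm, hb⟩
  rw [sum_congr rfl fun w hw => pmCount_insert_eq (mem_sdiff.1 hw).2 hbW, sum_const, smul_eq_mul,
    card_sdiff_of_subset (subset_univ _), card_univ, Fintype.card_fin, card_insert_of_notMem ha, hG.card_verts]
  congr 1

/-- **Honest moments.** For even `m`, the story value of every edge monomial is its expectation under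
the uniform distribution on perfect matchings: `Ẽ_m[x_G] · #PM(K_m) = #{M ∈ PM(K_m) : G ⊆ M}`
(for odd `m` both sides vanish term by term and the identity is empty).
[cite: Potechin2019, Cor. 3.10 and §6.4 (61:9, 61:16: "our story is honest for (n) whenever n is an even integer")] -/
theorem storyValue_mul_card_PM (G : Finset (Sym2 (Fin m))) :
    storyValue m G * ((PM m).card : ℝ) = (pmCount G : ℝ) := by
  classical
  induction G using Finset.induction_on with
  | empty =>
    rw [storyValue_empty, one_mul]
    unfold pmCount
    rw [filter_true_of_mem fun M _ => empty_subset M]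
  | insert e G heG ih =>
    by_cases h : IsPartialMatching (insert e G)
    · obtain ⟨a, b, rfl, hab, ha, hb⟩ := IsPartialMatching.exists_of_insert heG h
      have hG : IsPartialMatching G := h.subset (subset_insert _ _)
      have hrec := sub_mul_pmCount_insert (m := m) hG hab ha hb
      -- room: `2|G| + 2 ≤ m`
      have hroom : 2 * G.card + 2 ≤ m := by
        have h1 := h.card_verts
        rw [card_insert_of_notMem heG] at h1
        have h2 : (verts (insert s(a, b) G)).card ≤ m := by
          simpa using card_le_univ (verts (insert s(a, b) G))
        omega
      have hne : ((m : ℝ) - 1 - 2 * G.card) ≠ 0 := by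
        have : ((m - 2 * G.card - 1 : ℕ) : ℝ) = (m : ℝ) - 1 - 2 * G.card := by
          rw [Nat.cast_sub (by omega), Nat.cast_sub (by omega)]; push_cast; ring
        rw [← this]; exact_mod_cast (show m - 2 * G.card - 1 ≠ 0 by omega)
      rw [storyValue_of h, card_insert_of_notMem heG, moment_succ, ← storyValue_of hG]
      have hrec' : ((m : ℝ) - 1 - 2 * G.card) * (pmCount (insert s(a, b) G) : ℝ) = pmCount G := by
        have := congrArg (fun n : ℕ => (n : ℝ)) hrec
        push_cast at this
        rw [Nat.cast_sub (by omega), Nat.cast_sub (by omega)] at this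
        push_cast at this
        linarith [this]
      rw [← ih] at hrec'
      field_simp
      linarith [hrec']
    · rw [storyValue_of_not h, zero_mul, pmCount_eq_zero h, Nat.cast_zero]

/-! ### §B4 Outcomes inside a vertex set: honest counts -/

variable {n : ℕ}

/-- The perfect matchings of `K_m` whose restriction to `I` is exactly `F` (the honest event "`1_F`").
[cite: Potechin2019, Def. 5.2 and Def. 6.5 (61:11, 61:14)] -/
def Omega (I : Finset (Fin m)) (F : Finset (Sym2 (Fin m))) : Finset (Finset (Sym2 (Fin m))) :=
  (PM m).filter fun M => M ∩ innerEdges I = F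

/-- `#{M ∈ PM : C ⊆ M, M ∩ E(I) = F}`. [cite: Potechin2019, Def. 6.5 (61:14)] -/
def ocount (I : Finset (Fin m)) (F C : Finset (Sym2 (Fin m))) : ℕ := ((Omega I F).filter fun M => C ⊆ M).card

/-- Membership in an outcome class. [cite: Potechin2019, Def. 5.2 (61:11)] -/
theorem mem_Omega {I : Finset (Fin m)} {F M : Finset (Sym2 (Fin m))} :
    M ∈ Omega I F ↔ M ∈ PM m ∧ M ∩ innerEdges I = F := by
  simp [Omega]

/-- `M ∩ E = F` iff `F ⊆ M` and `M` avoids `E ∖ F` (for `F ⊆ E`). [cite: Potechin2019, Def. 5.2 (61:11)] -/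
theorem inter_eq_iff_subset_and_disjoint {E F M : Finset (Sym2 (Fin m))} (hF : F ⊆ E) :
    M ∩ E = F ↔ F ⊆ M ∧ (E \ F) ∩ M = ∅ := by
  constructor
  · intro h
    refine ⟨h ▸ inter_subset_left, ?_⟩
    rw [← h]; ext e; simp only [mem_inter, mem_sdiff, notMem_empty, iff_false]; tauto
  · rintro ⟨h1, h2⟩
    ext e
    simp only [mem_inter]
    constructor
    · rintro ⟨heM, heE⟩
      by_contra heF
      have : e ∈ (E \ F) ∩ M := mem_inter.2 ⟨mem_sdiff.2 ⟨heE, heF⟩, heM⟩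
      rw [h2] at this; exact notMem_empty e this
    · exact fun heF => ⟨h1 heF, hF heF⟩

/-- `#{M ⊇ G}` as a sum of indicators. [cite: Potechin2019, Prop. 2.18 (61:6)] -/
theorem pmCount_eq_sum (G : Finset (Sym2 (Fin m))) :
    (pmCount G : ℝ) = ∑ M ∈ PM m, if G ⊆ M then (1 : ℝ) else 0 := by
  unfold pmCount; rw [natCast_card_filter]

/-- `#{M ∈ Ω_F : C ⊆ M}` as a sum of indicators. [cite: Potechin2019, Def. 6.5 (61:14)] -/
theorem ocount_eq_sum (I : Finset (Fin m)) (F C : Finset (Sym2 (Fin m))) :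
    (ocount I F C : ℝ) = ∑ M ∈ PM m, if (M ∩ innerEdges I = F ∧ C ⊆ M) then (1 : ℝ) else 0 := by
  unfold ocount Omega; rw [filter_filter, natCast_card_filter]

/-- **Honest outcome values.** For `F ⊆ E(I)`:
`Ẽ_m[x_C 1_F] · #PM = #{M ∈ PM : C ⊆ M, M ∩ E(I) = F}` (inclusion–exclusion undone inside the honest
expectation). [cite: Potechin2019, Def. 6.5 (61:14, "S is honest … Ẽ_S[p] = E[p(σ(G₀))]")] -/
theorem outcomeValue_mul_card_PM {I : Finset (Fin m)} {F : Finset (Sym2 (Fin m))} (hF : F ⊆ innerEdges I)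
    (C : Finset (Sym2 (Fin m))) :
    outcomeValue m I F C * ((PM m).card : ℝ) = (ocount I F C : ℝ) := by
  classical
  set E := innerEdges I with hE
  have hmain : ∀ M ∈ PM m, ∑ S ∈ (E \ F).powerset, (-1 : ℝ) ^ S.card * (if C ∪ F ∪ S ⊆ M then (1 : ℝ) else 0)
      = if (M ∩ E = F ∧ C ⊆ M) then (1 : ℝ) else 0 := by
    intro M _
    by_cases hCF : C ∪ F ⊆ M
    · have hC : C ⊆ M := union_subset_left hCF
      have hFM : F ⊆ M := union_subset_right hCF
      have h1 : ∑ S ∈ (E \ F).powerset, (-1 : ℝ) ^ S.card * (if C ∪ F ∪ S ⊆ M then (1 : ℝ) else 0)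
          = ∑ S ∈ ((E \ F) ∩ M).powerset, (-1 : ℝ) ^ S.card := by
        rw [← sum_filter_add_sum_filter_not ((E \ F).powerset) (fun S => S ⊆ M)]
        have hA : ((E \ F).powerset.filter fun S => S ⊆ M) = ((E \ F) ∩ M).powerset := by
          ext S; simp only [mem_filter, mem_powerset, subset_inter_iff]
        rw [hA]
        have hB : ∑ S ∈ (E \ F).powerset.filter (fun S => ¬ S ⊆ M),
            (-1 : ℝ) ^ S.card * (if C ∪ F ∪ S ⊆ M then (1 : ℝ) else 0) = 0 := by
          refine sum_eq_zero fun S hS => ?_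
          have : ¬ (C ∪ F ∪ S ⊆ M) := fun h => (mem_filter.1 hS).2 (union_subset_right h)
          rw [if_neg this, mul_zero]
        rw [hB, add_zero]
        refine sum_congr rfl fun S hS => ?_
        have : C ∪ F ∪ S ⊆ M := union_subset hCF ((mem_powerset.1 hS).trans inter_subset_right)
        rw [if_pos this, mul_one]
      rw [h1]
      have h2 := sum_powerset_neg_one_pow_card (x := (E \ F) ∩ M)
      have h2' := congrArg (fun z : ℤ => (z : ℝ)) h2
      push_cast at h2'
      rw [h2']
      by_cases h0 : (E \ F) ∩ M = ∅
      · have : M ∩ E = F := (inter_eq_iff_subset_and_disjoint hF).2 ⟨hFM, h0⟩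
        rw [if_pos h0, if_pos ⟨this, hC⟩]
      · have : ¬ (M ∩ E = F ∧ C ⊆ M) := fun h => h0 ((inter_eq_iff_subset_and_disjoint hF).1 h.1).2
        rw [if_neg h0, if_neg this]
    · have h1 : ∀ S, ¬ (C ∪ F ∪ S ⊆ M) := fun S h => hCF (union_subset_left (s := C ∪ F) h)
      have h2 : ¬ (M ∩ E = F ∧ C ⊆ M) := by
        rintro ⟨hE', hC⟩
        exact hCF (union_subset hC (hE' ▸ inter_subset_left))
      simp_rw [if_neg (h1 _), mul_zero, sum_const_zero, if_neg h2]
  unfold outcomeValue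
  rw [sum_mul]
  simp_rw [mul_assoc, storyValue_mul_card_PM, pmCount_eq_sum, mul_sum, ocount_eq_sum]
  rw [sum_comm]
  exact sum_congr rfl hmain

/-! ### §B5 The stabiliser of `I` acts on the outcome classes; transitivity -/

/-- `stab` is antitone in the vertex set. [cite: Potechin2019, Theorem 4.1 (61:10)] -/
theorem stab_mono {I J : Finset (Fin n)} (h : J ⊆ I) : stab I ⊆ stab J :=
  fun _ hσ => mem_stab.2 fun j hj => mem_stab.1 hσ j (h hj)

/-- Edge sets inside `E(I)` have their vertices in `I`. [cite: Potechin2019, Def. 5.1 (61:11)] -/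
theorem verts_subset_of_subset_innerEdges {I : Finset (Fin n)} {F : Finset (Sym2 (Fin n))}
    (hF : F ⊆ innerEdges I) : verts F ⊆ I := fun v hv => by
  obtain ⟨e, he, hve⟩ := mem_verts.1 hv
  exact (mem_innerEdges.1 (hF he)) v hve

/-- The stabiliser of `I` fixes every edge set inside `E(I)`. [cite: Potechin2019, Def. 5.1 (61:11)] -/
theorem relabel_eq_self_of_subset_innerEdges {I : Finset (Fin n)} {F : Finset (Sym2 (Fin n))}
    (hF : F ⊆ innerEdges I) {σ : Equiv.Perm (Fin n)} (hσ : σ ∈ stab I) : relabel σ F = F :=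
  relabel_eq_self_of_mem_stab (stab_mono (verts_subset_of_subset_innerEdges hF) hσ)

/-- The stabiliser of `I` commutes with restriction to `E(I)`. [cite: Potechin2019, Def. 5.2 (61:11)] -/
theorem relabel_inter_innerEdges {I : Finset (Fin n)} {σ : Equiv.Perm (Fin n)} (hσ : σ ∈ stab I)
    (M : Finset (Sym2 (Fin n))) : relabel σ M ∩ innerEdges I = relabel σ (M ∩ innerEdges I) := by
  conv_lhs => rw [← relabel_eq_self_of_subset_innerEdges (subset_refl (innerEdges I)) hσ]
  rw [relabel, relabel, relabel, map_inter]

/-- The stabiliser of `I` preserves each outcome class `Ω_F`, `F ⊆ E(I)`. [cite: Potechin2019, Def. 5.2 (61:11)] -/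
theorem relabel_mem_Omega_iff {I : Finset (Fin m)} {F : Finset (Sym2 (Fin m))} (hF : F ⊆ innerEdges I)
    {σ : Equiv.Perm (Fin m)} (hσ : σ ∈ stab I) {M : Finset (Sym2 (Fin m))} :
    relabel σ M ∈ Omega I F ↔ M ∈ Omega I F := by
  rw [mem_Omega, mem_Omega, relabel_mem_PM_iff, relabel_inter_innerEdges hσ]
  conv_lhs => rw [← relabel_eq_self_of_subset_innerEdges hF hσ]
  rw [(relabel_injective σ).eq_iff]

/-- **Relative transitivity** (the tree's `exists_perm_fix_smul_eq`, Godsil–Meagher §15.2): two perfect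
matchings with the same restriction to `E(I)` differ by a permutation fixing `I` pointwise — in
Potechin's words, after conditioning on the outcome inside `I` the honest distribution is "the uniform
distribution for all permutations of an actual input graph `G₀` over `[1,n] ∖ I_A`".
[cite: Potechin2019, Def. 6.5 (61:14)] -/
theorem exists_mem_stab_relabel_eq {I : Finset (Fin m)} {F M M' : Finset (Sym2 (Fin m))}
    (hM : M ∈ Omega I F) (hM' : M' ∈ Omega I F) : ∃ π ∈ stab I, relabel π M = M' := by
  rw [mem_Omega, mem_perfectMatchings] at hM hM'
  obtain ⟨π, hπI, hπ⟩ := exists_perm_fix_smul_eq I (⟨M', hM'.1⟩ : PMSol m) ⟨M, hM.1⟩ (by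
    change M ∩ innerEdges I = M' ∩ innerEdges I; rw [hM.2, hM'.2])
  refine ⟨π, mem_stab.2 hπI, ?_⟩
  have := congrArg Subtype.val hπ
  rw [Literature.Combinatorics.Optimization.PMSol.smul_val] at this
  rw [relabel_eq_image]; exact this

/-- Counts of outcome-class matchings containing `σB` do not depend on `σ ∈ stab I`.
[cite: Potechin2019, Prop. 5.7 (61:11)] -/
theorem ocount_relabel {I : Finset (Fin m)} {F : Finset (Sym2 (Fin m))} (hF : F ⊆ innerEdges I)
    {σ : Equiv.Perm (Fin m)} (hσ : σ ∈ stab I) (B : Finset (Sym2 (Fin m))) :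
    ocount I F (relabel σ B) = ocount I F B := by
  unfold ocount
  refine card_nbij' (fun M => relabel σ⁻¹ M) (fun M => relabel σ M) (fun M hM => ?_) (fun M hM => ?_)
    (fun M _ => relabel_relabel_inv σ M) (fun M _ => relabel_inv_relabel σ M)
  · simp only [mem_coe, mem_filter] at hM ⊢
    refine ⟨(relabel_mem_Omega_iff hF (inv_mem_stab hσ)).2 hM.1, ?_⟩
    have := relabel_subset_relabel_iff (σ := σ⁻¹).2 hM.2
    rwa [relabel_inv_relabel] at this
  · simp only [mem_coe, mem_filter] at hM ⊢
    exact ⟨(relabel_mem_Omega_iff hF hσ).2 hM.1, relabel_subset_relabel_iff.2 hM.2⟩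

/-- The number of `σ ∈ stab I` with `σB ⊆ M` is the same for all `M` in one outcome class
(transport along the relative transitivity). [cite: Potechin2019, Prop. 5.7 (61:11)] -/
theorem card_stab_filter_eq {I : Finset (Fin m)} {F M M' : Finset (Sym2 (Fin m))}
    (hM : M ∈ Omega I F) (hM' : M' ∈ Omega I F) (B : Finset (Sym2 (Fin m))) :
    ((stab I).filter fun σ => relabel σ B ⊆ M).card = ((stab I).filter fun σ => relabel σ B ⊆ M').card := by
  obtain ⟨π, hπ, hπM⟩ := exists_mem_stab_relabel_eq hM hM'
  refine card_nbij' (fun σ => π * σ) (fun σ => π⁻¹ * σ) (fun σ hσ => ?_) (fun σ hσ => ?_)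
    (fun σ _ => by group) (fun σ _ => by group)
  · simp only [mem_coe, mem_filter] at hσ ⊢
    refine ⟨mul_mem_stab hπ hσ.1, ?_⟩
    rw [relabel_mul, ← hπM]; exact relabel_subset_relabel_iff.2 hσ.2
  · simp only [mem_coe, mem_filter] at hσ ⊢
    refine ⟨mul_mem_stab (inv_mem_stab hπ) hσ.1, ?_⟩
    have hMM : M = relabel π⁻¹ M' := by rw [← hπM, relabel_inv_relabel]
    rw [relabel_mul, hMM]; exact relabel_subset_relabel_iff.2 hσ.2

/-- **The honest identity, integer form.** For `F ⊆ E(I)` and all edge sets `A, B`: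
`#Ω_F · Σ_{σ ∈ stab I} #{M ∈ Ω_F : A ∪ σB ⊆ M} = #stab I · #{M ∈ Ω_F : A ⊆ M} · #{M ∈ Ω_F : B ⊆ M}`
— conditioned on the outcome inside `I`, the symmetrised `x_B` is constant (single-orbit measure),
so it decorrelates from everything. [cite: Potechin2019, Prop. 5.7 and Thm. 5.12 (2) (61:11–61:12)] -/
theorem card_Omega_mul_sum_ocount {I : Finset (Fin m)} {F : Finset (Sym2 (Fin m))} (hF : F ⊆ innerEdges I)
    (A B : Finset (Sym2 (Fin m))) :
    (Omega I F).card * ∑ σ ∈ stab I, ocount I F (A ∪ relabel σ B) =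
      (stab I).card * ocount I F A * ocount I F B := by
  classical
  set c : Finset (Sym2 (Fin m)) → ℕ := fun M => ((stab I).filter fun σ => relabel σ B ⊆ M).card with hc
  -- swap the sums
  have h1 : ∑ σ ∈ stab I, ocount I F (A ∪ relabel σ B) = ∑ M ∈ (Omega I F).filter (fun M => A ⊆ M), c M := by
    simp only [ocount, hc, card_eq_sum_ones, sum_filter, union_subset_iff]
    rw [sum_comm]
    refine sum_congr rfl fun M _ => ?_
    by_cases hA : A ⊆ M <;> simp [hA]
  have h2 : ∑ M ∈ Omega I F, c M = (stab I).card * ocount I F B := by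
    have hc' : ∀ M, c M = ∑ σ ∈ stab I, if relabel σ B ⊆ M then 1 else 0 := fun M => by
      simp only [hc, card_filter]
    simp_rw [hc']
    rw [sum_comm]
    have hσ' : ∀ σ ∈ stab I, ∑ M ∈ Omega I F, (if relabel σ B ⊆ M then 1 else 0) = ocount I F B :=
      fun σ hσ => by rw [← card_filter, ← ocount_relabel hF hσ B]; rfl
    rw [sum_congr rfl hσ', sum_const, smul_eq_mul]
  by_cases hne : (Omega I F).Nonempty
  · obtain ⟨M₀, hM₀⟩ := hne
    have hconst : ∀ M ∈ Omega I F, c M = c M₀ := fun M hM => card_stab_filter_eq hM hM₀ B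
    rw [h1, sum_congr rfl fun M hM => hconst M (mem_filter.1 hM).1, sum_const, smul_eq_mul]
    rw [sum_congr rfl hconst, sum_const, smul_eq_mul] at h2
    -- `|Ω| c₀ = |stab| ocount B`
    calc (Omega I F).card * (((Omega I F).filter fun M => A ⊆ M).card * c M₀)
        = ((Omega I F).card * c M₀) * ocount I F A := by unfold ocount; ring
      _ = (stab I).card * ocount I F B * ocount I F A := by rw [h2]
      _ = (stab I).card * ocount I F A * ocount I F B := by ring
  · rw [not_nonempty_iff_eq_empty] at hne
    simp [hne, ocount]

/-- **The honest identity, in story form** (even `m`, `F ⊆ E(I)`):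
`Ẽ[1_F] · Σ_{σ ∈ stab I} Ẽ[x_{A ∪ σB} 1_F] = #stab I · Ẽ[x_A 1_F] · Ẽ[x_B 1_F]`.
[cite: Potechin2019, Prop. 5.7 and Thm. 5.12 (2) (61:11–61:12)] -/
theorem outcomeValue_mul_sum_honest (hm : Even m) {I : Finset (Fin m)} {F : Finset (Sym2 (Fin m))}
    (hF : F ⊆ innerEdges I) (A B : Finset (Sym2 (Fin m))) :
    outcomeValue m I F ∅ * ∑ σ ∈ stab I, outcomeValue m I F (A ∪ relabel σ B) =
      ((stab I).card : ℝ) * outcomeValue m I F A * outcomeValue m I F B := by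
  have hP : ((PM m).card : ℝ) ≠ 0 := by exact_mod_cast (card_PM_pos hm).ne'
  have key := congrArg (fun z : ℕ => (z : ℝ)) (card_Omega_mul_sum_ocount hF A B)
  push_cast at key
  have h0 : ((Omega I F).card : ℝ) = outcomeValue m I F ∅ * (PM m).card := by
    rw [outcomeValue_mul_card_PM hF]; unfold ocount; rw [filter_true_of_mem fun M _ => empty_subset M]
  rw [h0, ← outcomeValue_mul_card_PM hF A, ← outcomeValue_mul_card_PM hF B] at key
  simp_rw [← outcomeValue_mul_card_PM hF (A ∪ relabel _ B)] at key
  rw [← sum_mul] at key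
  -- cancel `#PM²`
  have : (outcomeValue m I F ∅ * ∑ σ ∈ stab I, outcomeValue m I F (A ∪ relabel σ B)) * ((PM m).card : ℝ) ^ 2
      = (((stab I).card : ℝ) * outcomeValue m I F A * outcomeValue m I F B) * ((PM m).card : ℝ) ^ 2 := by
    linear_combination (key)
  exact mul_right_cancel₀ (pow_ne_zero 2 hP) this

/-! ### §B6 The order of the pointwise stabiliser -/

/-- `#stab I = (n − |I|)!` (the pointwise stabiliser of `I` is the symmetric group on the complement).
[cite: Potechin2019, Theorem 4.1 (61:10, "S_{[1,n] ∖ I}")] -/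
theorem card_stab (I : Finset (Fin n)) : (stab I).card = (n - I.card).factorial := by
  classical
  have e := Equiv.Perm.subtypeEquivSubtypePerm (fun x : Fin n => x ∉ I)
  have h1 : Fintype.card {f : Equiv.Perm (Fin n) // ∀ a, ¬ (a ∉ I) → f a = a} = (stab I).card := by
    rw [Fintype.card_subtype]
    congr 1
    ext σ
    simp only [mem_filter, mem_univ, true_and, not_not, mem_stab]
  have h2 : Fintype.card (Equiv.Perm {x : Fin n // x ∉ I}) = (n - I.card).factorial := by
    rw [Fintype.card_perm, Fintype.card_subtype_compl, Fintype.card_fin]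
    congr 2
    rw [Fintype.card_subtype]
    congr 1
    ext x; simp
  rw [← h1, ← Fintype.card_congr e, h2]

end PseudoMatching

end Literature.Computability.Complexity
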